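import Literature.NumberTheory.Rogawski1990.ArchWallOrbitMeasureTransport              -- ★ F0P3-p03 (g9) (R1-h-a,b) FILE OF RECORD: §1 generic `map_map_descConj_id_quotientMeasure_eq_of_mulEquiv`, `map_conj_eq_measure_univ_smul_map_descConj_id_quotientMeasure`
import Literature.NumberTheory.Rogawski1990.ArchStableTorusOrbitalWallSingularTerms   -- ★ (δ′) F0P3-p03: `relabel_inv_circleDiagonal`, `relabel_inv_mem_centralizer_circleDiagonal_comp_iff`, wall centraliser, compact-wall `CompactSpace`
import Literature.NumberTheory.Automorphic.OrbitalIntegralCentralTransport              -- ★ `InvariantQuotientTransport` (`map_cosetCongr_quotientMeasure`, `cosetCongr`)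
import Literature.MeasureTheory.Group.InvariantQuotientCompactSubgroup                 -- ★ `measure_univ_smul_quotientMeasure_eq_map_mk`, `quotientMeasure_eq_inv_smul_map_mk`
import Literature.NumberTheory.Automorphic.LocalOrbitalIntegrand                        -- ★ `continuous_descConj_id`
import Literature.MeasureTheory.Group.OrbitMeasureOfClosedClass                         -- ★ (R1-f) `isFiniteMeasureOnCompacts_map_descConj_id`
import Literature.NumberTheory.Automorphic.ArchSplitSemisimpleOrbitClosed               -- ★ `isClosed_conjClass_archLocal_of_mul_sub_eq_zero`
import Literature.NumberTheory.Automorphic.ArchLocalWallDescentCompact                  -- ★ `map_cmConjRingHom_transpose_diagonal`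
import HarnessLib

/-!
# Wall orbit MEASURES at the relabelled wall points `diag(z⁰ ∘ ρ)` of `G_w(α)`: the factors of the all-places end state as scalar multiples of THE Weil-quotient
# orbit measure at `diag(z⁰ ∘ ρ)` ((R1-h-a,b) readings in ★ (δ′)'s `relabel_inv` tokens; Rogawski 1990 §8.2 pp. 122–124; Deitmar–Echterhoff Thm. 1.5.3; Folland (2.52))

Topic `NumberTheory/Rogawski1990` (generic §1 in namespace `Literature.MeasureTheory.Group`, archimedean dress §2–§3 in `Literature.NumberTheory.Rogawski1990`).
THEOREMS ONLY (no `def`, no instance, no notation, no axiom, no named fact, no `sorry`).  Cell `pub/hodgecm-mathlib`, ENGINE T1 (crux H413 =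
`stmt-HodgeConjecture-24833`); floor-2 road «(J-nc) in-house», follow-on of ★ p842070 `ArchWallOrbitMeasureTransport` (F0P3-p03 (g9), file of record for (R1-h-a,b),
LEAD F0P3a-plan (g9) WORD T8-119∕T8-120; F0P3-p03 07:01:11Z «file them as the follow-on»); author F0P3a-p07 (g8), 2026-09-01.

WHY.  ★ p841776 `exists_wallCoef_sum_prod_mul_eq_of_regular_eq` ((R1-e-two)) ends the «method of §8.2» on a diagonal carrier with, for every relabelling family `ρ`, an integral
of the global test function against a PRODUCT over the complex places of per-place WALL FACTORS on `G_v(α) = archLocal L 3 (diagonal α) v`: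
`if (compact wall) then ν_v.map (y ↦ y·diag(z⁰_v∘ρ_v)·y⁻¹) else ((quotientMeasure Z(diag z₁_v) (νH_v ρ_v⁻¹) _ (ντ_v ρ_v⁻¹)).map orbit_{diag z⁰_v}).map e_{ρ_v⁻¹}` — the singular
branch living on the RELABELLED group `G_v(α∘ρ_v⁻¹)` with the transported Haar measure `ντ = (e_{ρ⁻¹}⁻¹)_* ν` carried as DATA.  ★ (R1-h-c) `ArchWallOrbitMeasureProduct` ∕ ★ (R1-c)
`ArchSingularOrbitalIntegralProductPlaces` (F0P3-p03) read a product of factors `c_v • (quotientMeasure Z(diag u_v) ρ_v _ ν_v).map orbit_{diag u_v}` — quotient by the centraliser of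
THE POINT ITSELF, `u_v = z⁰_v ∘ ρ_v` — as `(Π c_v) · Φ(⟦t(u)⟧, f; m)`.  This file supplies the per-place identities in exactly those tokens (★ p842070 §1 generic instantiated at
`H′ := Z(diag(z⁰∘ρ))` with ★ (δ′) `relabel_inv_mem_centralizer_circleDiagonal_comp_iff` as `hHH′`, so that neither a dependent rewrite `Z(diag(z₁∘ρ)) = Z(diag(z⁰∘ρ))` on the
quotient type nor a `map_map` round trip is left to the consumer):
* §1 generic extras over ★ p842070: `map_map_descConj_id_quotientMeasure_map_symm_eq` (source Haar `(e⁻¹)_* ν′`, the ★ (G2a) ∕ `ντ` currency) and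
  `map_descConj_id_quotientMeasure_eq_inv_smul_map_conj` (`[CompactSpace H]`: `(ν∕ρ).map orbit = ρ(H)⁻¹ • ν.map conj`);
* §2 (tokens of ★ p841776 ∕ ★ (δ′)): **`map_map_descConj_quotientMeasure_relabel_inv_eq_of_eq`** ((R1-h-a) at `diag(z⁰∘ρ)`, `hνH′` = ★ (δ′) (S2a)'s binder), its pull-back form
  `…_relabel_inv_pullback_eq` (★ (S2c) convention), **`map_conj_circleDiagonal_comp_eq_measure_univ_smul`** ((R1-h-b) at `diag(z⁰∘ρ)`), and the WHOLE factor: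
  **`wallFactor_eq_smul_map_descConj_quotientMeasure`** (`= (cw ? ρ_Z(Z) : 1) • orbit measure`, `ℝ≥0∞` scalar) and **`wallFactor_eq_nnreal_smul_map_descConj_quotientMeasure`**
  (`ℝ≥0` scalar `(cw ? (ρ_Z Z).toNNReal : 1)`, the currency of ★ (R1-h-c) `pi_nnreal_smul`; compactness of `Z` at a compact wall by ★ (δ′) (C0));
* §3 Radon: `mul_sub_eq_zero_circleDiagonal_comp_wall` (`diag(z⁰∘ρ)` is split semisimple) and **`isFiniteMeasureOnCompacts_and_sigmaFinite_map_descConj_quotientMeasure_wall`**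
  (the orbit measure at `diag(z⁰∘ρ)` is finite on compacts and σ-finite — ★ `isClosed_conjClass_archLocal_of_mul_sub_eq_zero` + ★ (R1-f); the `SigmaFinite` binders of ★ (R1-h-c)).
NOT HERE: the signed regrouping of the end-state sum over `ρ` into classes ((R1-h-d), next).
HONEST LABEL: HC_CM is proved only modulo the 7 printed citations until rung 0 closes; this file is measure bookkeeping and pays nothing by itself.

## References
* [Rogawski1990] J. D. Rogawski, *Automorphic Representations of Unitary Groups in Three Variables*, Ann. of Math. Stud. 123 (1990), §8.2 pp. 122–124, §1.7 p. 6, §4.3 (4.3.1).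
* [DeitmarEchterhoff2014] A. Deitmar, S. Echterhoff, *Principles of Harmonic Analysis*, 2nd ed. (2014), Thm. 1.5.3, Cor. 1.5.4.
* [Folland1995] G. B. Folland, *A Course in Abstract Harmonic Analysis* (1995), §2.6 Thm. 2.49, (2.52).
-/

set_option autoImplicit false

noncomputable section

open MeasureTheory Measure NumberField NumberField.InfinitePlace Equiv Topology
open Literature.MeasureTheory.Group Literature.NumberTheory.Automorphic Literature.NumberTheory.Automorphic.UnitaryGroup
open Literature.LinearAlgebra.Matrix
open scoped Matrix MatrixGroups NNReal ENNReal

/-! ## §1 Generic extras over ★ p842070: the source-Haar form and the compact-subgroup inverse reading -/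

namespace Literature.MeasureTheory.Group


section Transport

variable {G G' : Type*} [Group G] [Group G'] [TopologicalSpace G] [TopologicalSpace G']
  [IsTopologicalGroup G] [IsTopologicalGroup G'] [LocallyCompactSpace G] [LocallyCompactSpace G']
  [SecondCountableTopology G] [SecondCountableTopology G'] [T2Space G] [T2Space G']
  [MeasurableSpace G] [BorelSpace G] [MeasurableSpace G'] [BorelSpace G']
  (e : G ≃* G') (he : Continuous e) (hes : Continuous e.symm)
  (H : Subgroup G) [hH : IsClosed (H : Set G)] (H' : Subgroup G') [hH' : IsClosed (H' : Set G')]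
  (hHH' : ∀ g, e g ∈ H' ↔ g ∈ H)
  [MeasurableSpace (G ⧸ H)] [BorelSpace (G ⧸ H)] [MeasurableSpace (G' ⧸ H')] [BorelSpace (G' ⧸ H')]
  (ρ : Measure H) [ρ.IsMulLeftInvariant] [IsFiniteMeasureOnCompacts ρ] [ρ.IsOpenPosMeasure]
  [ρ.IsInvInvariant] [SFinite ρ]
  (ρ' : Measure H') [ρ'.IsMulLeftInvariant] [IsFiniteMeasureOnCompacts ρ'] [ρ'.IsOpenPosMeasure]
  [ρ'.IsInvInvariant] [SFinite ρ']
  (ν : Measure G) [IsHaarMeasure ν] [ν.IsMulRightInvariant]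
  (ν' : Measure G') [IsHaarMeasure ν'] [ν'.IsMulRightInvariant]

/-- **Source form** (the currency of ★ (G2a) ∕ ★ p841776: the Haar measure on the SOURCE is `(e⁻¹)_* ν′`): `(((e⁻¹)_*ν′ ∕ ρ).map orbit_γ).map e = (ν′∕ρ′).map orbit_{γ′}`.
[cite: DeitmarEchterhoff2014, Thm. 1.5.3] [cite: Rogawski1990, §1.7 p. 6] -/
theorem map_map_descConj_id_quotientMeasure_map_symm_eq
    [(ν'.map e.symm).IsHaarMeasure] [(ν'.map e.symm).IsMulRightInvariant]
    (hρ' : ρ' = Measure.map (subgroupCongrHomeomorph e H H' hHH' he hes) ρ)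
    {γ : G} {γ' : G'} (hγ : e γ = γ') (hHγ : ∀ g ∈ H, g * γ = γ * g) (hH'γ : ∀ g ∈ H', g * γ' = γ' * g) :
    ((quotientMeasure H ρ hH (ν'.map e.symm)).map (descConj γ H hHγ id)).map e = (quotientMeasure H' ρ' hH' ν').map (descConj γ' H' hH'γ id) := by
  have hν : ν' = (ν'.map e.symm).map e := by
    rw [Measure.map_map he.measurable hes.measurable]
    have : ((e : G → G') ∘ (e.symm : G' → G)) = id := funext fun x => e.apply_symm_apply x
    rw [this, Measure.map_id]
  exact map_map_descConj_id_quotientMeasure_eq_of_mulEquiv e he hes H H' hHH' ρ ρ' (ν'.map e.symm) ν' hρ' hν hγ hHγ hH'γ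

omit [LocallyCompactSpace G'] [SecondCountableTopology G'] [T2Space G'] [BorelSpace G'] hH'
  [MeasurableSpace (G' ⧸ H')] [BorelSpace (G' ⧸ H')]
  [ρ'.IsMulLeftInvariant] [IsFiniteMeasureOnCompacts ρ'] [ρ'.IsOpenPosMeasure] [ρ'.IsInvInvariant] [SFinite ρ']
  [IsHaarMeasure ν'] [ν'.IsMulRightInvariant] in
/-- **Compact `H`: the orbit measure is `ρ(H)⁻¹` times the Haar push-forward**, `(ν∕ρ).map (yH ↦ yγy⁻¹) = ρ(H)⁻¹ • ν.map (x ↦ xγx⁻¹)` (★ `quotientMeasure_eq_inv_smul_map_mk`).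
[cite: Folland1995, §2.6 Thm. 2.49, (2.52)] [cite: DeitmarEchterhoff2014, Cor. 1.5.4] -/
theorem map_descConj_id_quotientMeasure_eq_inv_smul_map_conj [CompactSpace H] {γ : G} (hHγ : ∀ g ∈ H, g * γ = γ * g) :
    (quotientMeasure H ρ hH ν).map (descConj γ H hHγ id) = (ρ Set.univ)⁻¹ • ν.map (fun x : G => x * γ * x⁻¹) := by
  rw [quotientMeasure_eq_inv_smul_map_mk H ρ ν, Measure.map_smul,
    Measure.map_map (continuous_descConj_id γ H hHγ).measurable QuotientGroup.continuous_mk.measurable]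
  rfl

end Transport

end Literature.MeasureTheory.Group


/-! ## §2 The carrier `G_w(α) = archLocal L 3 (diagonal α) w`: the wall measures of ★ p841776 as Weil-quotient orbit measures AT `diag(z⁰ ∘ ρ)` -/

namespace Literature.NumberTheory.Rogawski1990

section Carrier

variable (L : Type) [Field L] (α : Fin 3 → L) (w : {w : InfinitePlace L // IsComplex w})
  [MeasurableSpace (GL (Fin 3) ℂ)] [BorelSpace (GL (Fin 3) ℂ)]
  (ν : Measure (archLocal L 3 (Matrix.diagonal α) w)) [ν.IsHaarMeasure] [ν.IsMulRightInvariant]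
  {z₁ z₀ : Fin 3 → Circle} (h02 : z₁ 0 = z₁ 2) (h01 : z₁ 0 ≠ z₁ 1) (h02' : z₀ 0 = z₀ 2) (h01' : z₀ 0 ≠ z₀ 1)

/-- **(R1-h-a) THE SINGULAR WALL MEASURE, TRANSPORTED ALONG THE RELABELLING ISO, IS THE WEIL-QUOTIENT ORBIT MEASURE OF `G_w(α)` AT `diag(z⁰ ∘ ρ)`.**  Tokens of ★ p841776's
noncompact-wall factor: source group `G_w(α ∘ ρ⁻¹)`, reference wall centraliser `Z(diag z₁) (= Z(diag z⁰))`, Haar `νH` on it, the transported Haar measure `ντ = (e_{ρ⁻¹}⁻¹)_* ν`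
passed as DATA (equation `hντ`), orbit map at `diag z⁰`, then `e_{ρ⁻¹}`; target: `G_w(α) ⧸ Z(diag(z⁰∘ρ))` with the transported centraliser measure `νH′ = (e_{ρ⁻¹}|_Z)_* νH` (the
convention of ★ (δ′) (S2a) ∕ ★ (G2a)), orbit map at `diag(z⁰∘ρ)` (§1 + ★ `relabel_inv_circleDiagonal` + ★ `relabel_inv_mem_centralizer_circleDiagonal_comp_iff`).
[cite: Rogawski1990, §8.2 pp. 122–124; §1.7 p. 6] [cite: DeitmarEchterhoff2014, Thm. 1.5.3] -/
theorem map_map_descConj_quotientMeasure_relabel_inv_eq_of_eq (ρ : Perm (Fin 3))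
    [MeasurableSpace (archLocal L 3 (Matrix.diagonal (α ∘ ⇑ρ⁻¹)) w ⧸ (Subgroup.centralizer ({(⟨circleDiagonal 3 z₁, circleDiagonal_mem_archLocal_diagonal L 3 (α ∘ ⇑ρ⁻¹) w z₁⟩ : archLocal L 3 (Matrix.diagonal (α ∘ ⇑ρ⁻¹)) w)} : Set (archLocal L 3 (Matrix.diagonal (α ∘ ⇑ρ⁻¹)) w))))] [BorelSpace (archLocal L 3 (Matrix.diagonal (α ∘ ⇑ρ⁻¹)) w ⧸ (Subgroup.centralizer ({(⟨circleDiagonal 3 z₁, circleDiagonal_mem_archLocal_diagonal L 3 (α ∘ ⇑ρ⁻¹) w z₁⟩ : archLocal L 3 (Matrix.diagonal (α ∘ ⇑ρ⁻¹)) w)} : Set (archLocal L 3 (Matrix.diagonal (α ∘ ⇑ρ⁻¹)) w))))]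
    [MeasurableSpace (archLocal L 3 (Matrix.diagonal α) w ⧸ (Subgroup.centralizer ({(⟨circleDiagonal 3 (z₀ ∘ ⇑ρ), circleDiagonal_mem_archLocal_diagonal L 3 α w (z₀ ∘ ⇑ρ)⟩ : archLocal L 3 (Matrix.diagonal α) w)} : Set (archLocal L 3 (Matrix.diagonal α) w))))] [BorelSpace (archLocal L 3 (Matrix.diagonal α) w ⧸ (Subgroup.centralizer ({(⟨circleDiagonal 3 (z₀ ∘ ⇑ρ), circleDiagonal_mem_archLocal_diagonal L 3 α w (z₀ ∘ ⇑ρ)⟩ : archLocal L 3 (Matrix.diagonal α) w)} : Set (archLocal L 3 (Matrix.diagonal α) w))))]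
    (νH : Measure (Subgroup.centralizer ({(⟨circleDiagonal 3 z₁, circleDiagonal_mem_archLocal_diagonal L 3 (α ∘ ⇑ρ⁻¹) w z₁⟩ : archLocal L 3 (Matrix.diagonal (α ∘ ⇑ρ⁻¹)) w)} : Set (archLocal L 3 (Matrix.diagonal (α ∘ ⇑ρ⁻¹)) w)))) [νH.IsHaarMeasure] [νH.IsInvInvariant]
    (νH' : Measure (Subgroup.centralizer ({(⟨circleDiagonal 3 (z₀ ∘ ⇑ρ), circleDiagonal_mem_archLocal_diagonal L 3 α w (z₀ ∘ ⇑ρ)⟩ : archLocal L 3 (Matrix.diagonal α) w)} : Set (archLocal L 3 (Matrix.diagonal α) w)))) [νH'.IsHaarMeasure] [νH'.IsInvInvariant]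
    (hνH' : νH' = νH.map (subgroupCongrHomeomorph (ContinuousMulEquiv.restrictSubgroup (GLn.conjEquiv (Matrix.GeneralLinearGroup.mkOfDetNeZero _ (det_monomial_one_ne_zero 3 ρ⁻¹)))
        (archLocal L 3 (Matrix.diagonal (α ∘ ⇑ρ⁻¹)) w) (archLocal L 3 (Matrix.diagonal α) w) (mem_archLocal_comp_perm_iff_conj_mem L 3 α w ρ⁻¹)).toMulEquiv (Subgroup.centralizer ({(⟨circleDiagonal 3 z₁, circleDiagonal_mem_archLocal_diagonal L 3 (α ∘ ⇑ρ⁻¹) w z₁⟩ : archLocal L 3 (Matrix.diagonal (α ∘ ⇑ρ⁻¹)) w)} : Set (archLocal L 3 (Matrix.diagonal (α ∘ ⇑ρ⁻¹)) w))) (Subgroup.centralizer ({(⟨circleDiagonal 3 (z₀ ∘ ⇑ρ), circleDiagonal_mem_archLocal_diagonal L 3 α w (z₀ ∘ ⇑ρ)⟩ : archLocal L 3 (Matrix.diagonal α) w)} : Set (archLocal L 3 (Matrix.diagonal α) w)))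
      (relabel_inv_mem_centralizer_circleDiagonal_comp_iff L α w ρ h02 h01 h02' h01') (ContinuousMulEquiv.restrictSubgroup (GLn.conjEquiv (Matrix.GeneralLinearGroup.mkOfDetNeZero _ (det_monomial_one_ne_zero 3 ρ⁻¹)))
        (archLocal L 3 (Matrix.diagonal (α ∘ ⇑ρ⁻¹)) w) (archLocal L 3 (Matrix.diagonal α) w) (mem_archLocal_comp_perm_iff_conj_mem L 3 α w ρ⁻¹)).continuous (ContinuousMulEquiv.restrictSubgroup (GLn.conjEquiv (Matrix.GeneralLinearGroup.mkOfDetNeZero _ (det_monomial_one_ne_zero 3 ρ⁻¹)))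
        (archLocal L 3 (Matrix.diagonal (α ∘ ⇑ρ⁻¹)) w) (archLocal L 3 (Matrix.diagonal α) w) (mem_archLocal_comp_perm_iff_conj_mem L 3 α w ρ⁻¹)).symm.continuous))
    (ντ : Measure (archLocal L 3 (Matrix.diagonal (α ∘ ⇑ρ⁻¹)) w)) [ντ.IsHaarMeasure] [ντ.IsMulRightInvariant]
    (hντ : ντ = ν.map (ContinuousMulEquiv.restrictSubgroup (GLn.conjEquiv (Matrix.GeneralLinearGroup.mkOfDetNeZero _ (det_monomial_one_ne_zero 3 ρ⁻¹)))
        (archLocal L 3 (Matrix.diagonal (α ∘ ⇑ρ⁻¹)) w) (archLocal L 3 (Matrix.diagonal α) w) (mem_archLocal_comp_perm_iff_conj_mem L 3 α w ρ⁻¹)).symm) :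
    haveI : LocallyCompactSpace (archLocal L 3 (Matrix.diagonal (α ∘ ⇑ρ⁻¹)) w) := locallyCompactSpace_archLocal L 3 (Matrix.diagonal (α ∘ ⇑ρ⁻¹)) w
    haveI : SecondCountableTopology (archLocal L 3 (Matrix.diagonal (α ∘ ⇑ρ⁻¹)) w) := secondCountableTopology_archLocal L 3 (Matrix.diagonal (α ∘ ⇑ρ⁻¹)) w
    haveI : LocallyCompactSpace (archLocal L 3 (Matrix.diagonal α) w) := locallyCompactSpace_archLocal L 3 (Matrix.diagonal α) w
    haveI : SecondCountableTopology (archLocal L 3 (Matrix.diagonal α) w) := secondCountableTopology_archLocal L 3 (Matrix.diagonal α) w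
    ((quotientMeasure _ νH (isClosed_coe_centralizer_singleton _) ντ).map
        (descConj (⟨circleDiagonal 3 z₀, circleDiagonal_mem_archLocal_diagonal L 3 (α ∘ ⇑ρ⁻¹) w z₀⟩ : archLocal L 3 (Matrix.diagonal (α ∘ ⇑ρ⁻¹)) w) (Subgroup.centralizer ({(⟨circleDiagonal 3 z₁, circleDiagonal_mem_archLocal_diagonal L 3 (α ∘ ⇑ρ⁻¹) w z₁⟩ : archLocal L 3 (Matrix.diagonal (α ∘ ⇑ρ⁻¹)) w)} : Set (archLocal L 3 (Matrix.diagonal (α ∘ ⇑ρ⁻¹)) w))) (forall_mem_centralizer_circleDiagonal_comm_of_wall L (α ∘ ⇑ρ⁻¹) w h02 h01 h02' h01') id)).map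
      (ContinuousMulEquiv.restrictSubgroup (GLn.conjEquiv (Matrix.GeneralLinearGroup.mkOfDetNeZero _ (det_monomial_one_ne_zero 3 ρ⁻¹)))
        (archLocal L 3 (Matrix.diagonal (α ∘ ⇑ρ⁻¹)) w) (archLocal L 3 (Matrix.diagonal α) w) (mem_archLocal_comp_perm_iff_conj_mem L 3 α w ρ⁻¹)) =
      (quotientMeasure _ νH' (isClosed_coe_centralizer_singleton _) ν).map
        (descConj (⟨circleDiagonal 3 (z₀ ∘ ⇑ρ), circleDiagonal_mem_archLocal_diagonal L 3 α w (z₀ ∘ ⇑ρ)⟩ : archLocal L 3 (Matrix.diagonal α) w) (Subgroup.centralizer ({(⟨circleDiagonal 3 (z₀ ∘ ⇑ρ), circleDiagonal_mem_archLocal_diagonal L 3 α w (z₀ ∘ ⇑ρ)⟩ : archLocal L 3 (Matrix.diagonal α) w)} : Set (archLocal L 3 (Matrix.diagonal α) w))) (fun _ hg => Subgroup.mem_centralizer_singleton_iff.1 hg) id) := by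
  haveI : LocallyCompactSpace (archLocal L 3 (Matrix.diagonal (α ∘ ⇑ρ⁻¹)) w) := locallyCompactSpace_archLocal L 3 (Matrix.diagonal (α ∘ ⇑ρ⁻¹)) w
  haveI : SecondCountableTopology (archLocal L 3 (Matrix.diagonal (α ∘ ⇑ρ⁻¹)) w) := secondCountableTopology_archLocal L 3 (Matrix.diagonal (α ∘ ⇑ρ⁻¹)) w
  haveI : LocallyCompactSpace (archLocal L 3 (Matrix.diagonal α) w) := locallyCompactSpace_archLocal L 3 (Matrix.diagonal α) w
  haveI : SecondCountableTopology (archLocal L 3 (Matrix.diagonal α) w) := secondCountableTopology_archLocal L 3 (Matrix.diagonal α) w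
  haveI : LocallyCompactSpace (Subgroup.centralizer ({(⟨circleDiagonal 3 z₁, circleDiagonal_mem_archLocal_diagonal L 3 (α ∘ ⇑ρ⁻¹) w z₁⟩ : archLocal L 3 (Matrix.diagonal (α ∘ ⇑ρ⁻¹)) w)} : Set (archLocal L 3 (Matrix.diagonal (α ∘ ⇑ρ⁻¹)) w))) := (isClosed_coe_centralizer_singleton _).isClosedEmbedding_subtypeVal.locallyCompactSpace
  haveI : LocallyCompactSpace (Subgroup.centralizer ({(⟨circleDiagonal 3 (z₀ ∘ ⇑ρ), circleDiagonal_mem_archLocal_diagonal L 3 α w (z₀ ∘ ⇑ρ)⟩ : archLocal L 3 (Matrix.diagonal α) w)} : Set (archLocal L 3 (Matrix.diagonal α) w))) := (isClosed_coe_centralizer_singleton _).isClosedEmbedding_subtypeVal.locallyCompactSpace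
  set e := (ContinuousMulEquiv.restrictSubgroup (GLn.conjEquiv (Matrix.GeneralLinearGroup.mkOfDetNeZero _ (det_monomial_one_ne_zero 3 ρ⁻¹)))
        (archLocal L 3 (Matrix.diagonal (α ∘ ⇑ρ⁻¹)) w) (archLocal L 3 (Matrix.diagonal α) w) (mem_archLocal_comp_perm_iff_conj_mem L 3 α w ρ⁻¹)) with he_def
  haveI : IsClosed (((Subgroup.centralizer ({(⟨circleDiagonal 3 z₁, circleDiagonal_mem_archLocal_diagonal L 3 (α ∘ ⇑ρ⁻¹) w z₁⟩ : archLocal L 3 (Matrix.diagonal (α ∘ ⇑ρ⁻¹)) w)} : Set (archLocal L 3 (Matrix.diagonal (α ∘ ⇑ρ⁻¹)) w))) : Subgroup (archLocal L 3 (Matrix.diagonal (α ∘ ⇑ρ⁻¹)) w)) : Set (archLocal L 3 (Matrix.diagonal (α ∘ ⇑ρ⁻¹)) w)) := isClosed_coe_centralizer_singleton _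
  haveI : IsClosed (((Subgroup.centralizer ({(⟨circleDiagonal 3 (z₀ ∘ ⇑ρ), circleDiagonal_mem_archLocal_diagonal L 3 α w (z₀ ∘ ⇑ρ)⟩ : archLocal L 3 (Matrix.diagonal α) w)} : Set (archLocal L 3 (Matrix.diagonal α) w))) : Subgroup (archLocal L 3 (Matrix.diagonal α) w)) : Set (archLocal L 3 (Matrix.diagonal α) w)) := isClosed_coe_centralizer_singleton _
  have hme : Measurable (⇑e.toMulEquiv) := e.continuous.measurable
  have hν' : ν = Measure.map (⇑e.toMulEquiv) ντ := by
    have hms : Measurable (⇑e.symm) := e.symm.continuous.measurable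
    rw [hντ, Measure.map_map hme hms]
    have hcomp : (⇑e.toMulEquiv ∘ ⇑e.symm) = id := funext fun x => e.apply_symm_apply x
    rw [hcomp, Measure.map_id]
  exact map_map_descConj_id_quotientMeasure_eq_of_mulEquiv e.toMulEquiv e.continuous e.symm.continuous
    (Subgroup.centralizer ({(⟨circleDiagonal 3 z₁, circleDiagonal_mem_archLocal_diagonal L 3 (α ∘ ⇑ρ⁻¹) w z₁⟩ : archLocal L 3 (Matrix.diagonal (α ∘ ⇑ρ⁻¹)) w)} : Set (archLocal L 3 (Matrix.diagonal (α ∘ ⇑ρ⁻¹)) w))) (Subgroup.centralizer ({(⟨circleDiagonal 3 (z₀ ∘ ⇑ρ), circleDiagonal_mem_archLocal_diagonal L 3 α w (z₀ ∘ ⇑ρ)⟩ : archLocal L 3 (Matrix.diagonal α) w)} : Set (archLocal L 3 (Matrix.diagonal α) w))) (relabel_inv_mem_centralizer_circleDiagonal_comp_iff L α w ρ h02 h01 h02' h01') νH νH' ντ ν hνH' hν' (relabel_inv_circleDiagonal L α w ρ z₀)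
    (forall_mem_centralizer_circleDiagonal_comm_of_wall L (α ∘ ⇑ρ⁻¹) w h02 h01 h02' h01') (fun _ hg => Subgroup.mem_centralizer_singleton_iff.1 hg)

/-- **(R1-h-b) THE COMPACT-WALL FACTOR IS `ρ_Z(Z)` TIMES THE WEIL-QUOTIENT ORBIT MEASURE AT `diag(z⁰ ∘ ρ)`**: `ν.map (y ↦ y·diag(z⁰∘ρ)·y⁻¹) = ρ_Z(Z(diag(z⁰∘ρ))) • (ν∕ρ_Z).map orbit`
for ANY inversion-invariant Haar measure `ρ_Z` on the centraliser (§1; at a compact wall `Z ≅ U(2) × U(1)` is compact, ★ `compactSpace_centralizer_circleDiagonal_comp_of_pos`, so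
`0 < ρ_Z(Z) < ∞` — the «compatible measures» factor of print). [cite: Rogawski1990, §8.2 p. 123; §1.7 p. 6] [cite: Folland1995, §2.6 (2.52)] [cite: DeitmarEchterhoff2014, Cor. 1.5.4] -/
theorem map_conj_circleDiagonal_comp_eq_measure_univ_smul (ρ : Perm (Fin 3))
    [MeasurableSpace (archLocal L 3 (Matrix.diagonal α) w ⧸ (Subgroup.centralizer ({(⟨circleDiagonal 3 (z₀ ∘ ⇑ρ), circleDiagonal_mem_archLocal_diagonal L 3 α w (z₀ ∘ ⇑ρ)⟩ : archLocal L 3 (Matrix.diagonal α) w)} : Set (archLocal L 3 (Matrix.diagonal α) w))))] [BorelSpace (archLocal L 3 (Matrix.diagonal α) w ⧸ (Subgroup.centralizer ({(⟨circleDiagonal 3 (z₀ ∘ ⇑ρ), circleDiagonal_mem_archLocal_diagonal L 3 α w (z₀ ∘ ⇑ρ)⟩ : archLocal L 3 (Matrix.diagonal α) w)} : Set (archLocal L 3 (Matrix.diagonal α) w))))]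
    (ρZ : Measure (Subgroup.centralizer ({(⟨circleDiagonal 3 (z₀ ∘ ⇑ρ), circleDiagonal_mem_archLocal_diagonal L 3 α w (z₀ ∘ ⇑ρ)⟩ : archLocal L 3 (Matrix.diagonal α) w)} : Set (archLocal L 3 (Matrix.diagonal α) w)))) [ρZ.IsHaarMeasure] [ρZ.IsInvInvariant] :
    haveI : LocallyCompactSpace (archLocal L 3 (Matrix.diagonal α) w) := locallyCompactSpace_archLocal L 3 (Matrix.diagonal α) w
    haveI : SecondCountableTopology (archLocal L 3 (Matrix.diagonal α) w) := secondCountableTopology_archLocal L 3 (Matrix.diagonal α) w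
    ν.map (fun y : archLocal L 3 (Matrix.diagonal α) w => y * (⟨circleDiagonal 3 (z₀ ∘ ⇑ρ), circleDiagonal_mem_archLocal_diagonal L 3 α w (z₀ ∘ ⇑ρ)⟩ : archLocal L 3 (Matrix.diagonal α) w) * y⁻¹) =
      ρZ Set.univ • (quotientMeasure _ ρZ (isClosed_coe_centralizer_singleton _) ν).map
        (descConj (⟨circleDiagonal 3 (z₀ ∘ ⇑ρ), circleDiagonal_mem_archLocal_diagonal L 3 α w (z₀ ∘ ⇑ρ)⟩ : archLocal L 3 (Matrix.diagonal α) w) (Subgroup.centralizer ({(⟨circleDiagonal 3 (z₀ ∘ ⇑ρ), circleDiagonal_mem_archLocal_diagonal L 3 α w (z₀ ∘ ⇑ρ)⟩ : archLocal L 3 (Matrix.diagonal α) w)} : Set (archLocal L 3 (Matrix.diagonal α) w))) (fun _ hg => Subgroup.mem_centralizer_singleton_iff.1 hg) id) := by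
  haveI : LocallyCompactSpace (archLocal L 3 (Matrix.diagonal α) w) := locallyCompactSpace_archLocal L 3 (Matrix.diagonal α) w
  haveI : SecondCountableTopology (archLocal L 3 (Matrix.diagonal α) w) := secondCountableTopology_archLocal L 3 (Matrix.diagonal α) w
  haveI : LocallyCompactSpace (Subgroup.centralizer ({(⟨circleDiagonal 3 (z₀ ∘ ⇑ρ), circleDiagonal_mem_archLocal_diagonal L 3 α w (z₀ ∘ ⇑ρ)⟩ : archLocal L 3 (Matrix.diagonal α) w)} : Set (archLocal L 3 (Matrix.diagonal α) w))) := (isClosed_coe_centralizer_singleton _).isClosedEmbedding_subtypeVal.locallyCompactSpace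
  haveI : IsClosed (((Subgroup.centralizer ({(⟨circleDiagonal 3 (z₀ ∘ ⇑ρ), circleDiagonal_mem_archLocal_diagonal L 3 α w (z₀ ∘ ⇑ρ)⟩ : archLocal L 3 (Matrix.diagonal α) w)} : Set (archLocal L 3 (Matrix.diagonal α) w))) : Subgroup (archLocal L 3 (Matrix.diagonal α) w)) : Set (archLocal L 3 (Matrix.diagonal α) w)) := isClosed_coe_centralizer_singleton _
  exact map_conj_eq_measure_univ_smul_map_descConj_id_quotientMeasure (Subgroup.centralizer ({(⟨circleDiagonal 3 (z₀ ∘ ⇑ρ), circleDiagonal_mem_archLocal_diagonal L 3 α w (z₀ ∘ ⇑ρ)⟩ : archLocal L 3 (Matrix.diagonal α) w)} : Set (archLocal L 3 (Matrix.diagonal α) w))) ρZ ν (fun _ hg => Subgroup.mem_centralizer_singleton_iff.1 hg)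

/-- **THE PULL-BACK CONVENTION** (★ (δ′) (S2c) ∕ ★ (G2c)): when the reference-wall Haar measure on the SOURCE is DEFINED as the pull-back `νH := (e_{ρ⁻¹}|_Z)⁻¹_* ρ_Z` of a centraliser
measure `ρ_Z` on `Z(diag(z⁰∘ρ)) ≤ G_w(α)` (e.g. the top-form measure of the point-Weil family), (R1-h-a) reads with `ρ_Z` itself on the right — no compatibility constant.
[cite: Rogawski1990, §8.2 pp. 122–124; §1.7 p. 6] [cite: DeitmarEchterhoff2014, Thm. 1.5.3] -/
theorem map_map_descConj_quotientMeasure_relabel_inv_pullback_eq (ρ : Perm (Fin 3))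
    [MeasurableSpace (archLocal L 3 (Matrix.diagonal (α ∘ ⇑ρ⁻¹)) w ⧸ (Subgroup.centralizer ({(⟨circleDiagonal 3 z₁, circleDiagonal_mem_archLocal_diagonal L 3 (α ∘ ⇑ρ⁻¹) w z₁⟩ : archLocal L 3 (Matrix.diagonal (α ∘ ⇑ρ⁻¹)) w)} : Set (archLocal L 3 (Matrix.diagonal (α ∘ ⇑ρ⁻¹)) w))))] [BorelSpace (archLocal L 3 (Matrix.diagonal (α ∘ ⇑ρ⁻¹)) w ⧸ (Subgroup.centralizer ({(⟨circleDiagonal 3 z₁, circleDiagonal_mem_archLocal_diagonal L 3 (α ∘ ⇑ρ⁻¹) w z₁⟩ : archLocal L 3 (Matrix.diagonal (α ∘ ⇑ρ⁻¹)) w)} : Set (archLocal L 3 (Matrix.diagonal (α ∘ ⇑ρ⁻¹)) w))))]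
    [MeasurableSpace (archLocal L 3 (Matrix.diagonal α) w ⧸ (Subgroup.centralizer ({(⟨circleDiagonal 3 (z₀ ∘ ⇑ρ), circleDiagonal_mem_archLocal_diagonal L 3 α w (z₀ ∘ ⇑ρ)⟩ : archLocal L 3 (Matrix.diagonal α) w)} : Set (archLocal L 3 (Matrix.diagonal α) w))))] [BorelSpace (archLocal L 3 (Matrix.diagonal α) w ⧸ (Subgroup.centralizer ({(⟨circleDiagonal 3 (z₀ ∘ ⇑ρ), circleDiagonal_mem_archLocal_diagonal L 3 α w (z₀ ∘ ⇑ρ)⟩ : archLocal L 3 (Matrix.diagonal α) w)} : Set (archLocal L 3 (Matrix.diagonal α) w))))]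
    (ρZ : Measure (Subgroup.centralizer ({(⟨circleDiagonal 3 (z₀ ∘ ⇑ρ), circleDiagonal_mem_archLocal_diagonal L 3 α w (z₀ ∘ ⇑ρ)⟩ : archLocal L 3 (Matrix.diagonal α) w)} : Set (archLocal L 3 (Matrix.diagonal α) w)))) [ρZ.IsHaarMeasure] [ρZ.IsInvInvariant]
    (νH : Measure (Subgroup.centralizer ({(⟨circleDiagonal 3 z₁, circleDiagonal_mem_archLocal_diagonal L 3 (α ∘ ⇑ρ⁻¹) w z₁⟩ : archLocal L 3 (Matrix.diagonal (α ∘ ⇑ρ⁻¹)) w)} : Set (archLocal L 3 (Matrix.diagonal (α ∘ ⇑ρ⁻¹)) w)))) [νH.IsHaarMeasure] [νH.IsInvInvariant]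
    (hνH : νH = ρZ.map (subgroupCongrHomeomorph (ContinuousMulEquiv.restrictSubgroup (GLn.conjEquiv (Matrix.GeneralLinearGroup.mkOfDetNeZero _ (det_monomial_one_ne_zero 3 ρ⁻¹)))
        (archLocal L 3 (Matrix.diagonal (α ∘ ⇑ρ⁻¹)) w) (archLocal L 3 (Matrix.diagonal α) w) (mem_archLocal_comp_perm_iff_conj_mem L 3 α w ρ⁻¹)).toMulEquiv (Subgroup.centralizer ({(⟨circleDiagonal 3 z₁, circleDiagonal_mem_archLocal_diagonal L 3 (α ∘ ⇑ρ⁻¹) w z₁⟩ : archLocal L 3 (Matrix.diagonal (α ∘ ⇑ρ⁻¹)) w)} : Set (archLocal L 3 (Matrix.diagonal (α ∘ ⇑ρ⁻¹)) w))) (Subgroup.centralizer ({(⟨circleDiagonal 3 (z₀ ∘ ⇑ρ), circleDiagonal_mem_archLocal_diagonal L 3 α w (z₀ ∘ ⇑ρ)⟩ : archLocal L 3 (Matrix.diagonal α) w)} : Set (archLocal L 3 (Matrix.diagonal α) w)))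
      (relabel_inv_mem_centralizer_circleDiagonal_comp_iff L α w ρ h02 h01 h02' h01') (ContinuousMulEquiv.restrictSubgroup (GLn.conjEquiv (Matrix.GeneralLinearGroup.mkOfDetNeZero _ (det_monomial_one_ne_zero 3 ρ⁻¹)))
        (archLocal L 3 (Matrix.diagonal (α ∘ ⇑ρ⁻¹)) w) (archLocal L 3 (Matrix.diagonal α) w) (mem_archLocal_comp_perm_iff_conj_mem L 3 α w ρ⁻¹)).continuous (ContinuousMulEquiv.restrictSubgroup (GLn.conjEquiv (Matrix.GeneralLinearGroup.mkOfDetNeZero _ (det_monomial_one_ne_zero 3 ρ⁻¹)))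
        (archLocal L 3 (Matrix.diagonal (α ∘ ⇑ρ⁻¹)) w) (archLocal L 3 (Matrix.diagonal α) w) (mem_archLocal_comp_perm_iff_conj_mem L 3 α w ρ⁻¹)).symm.continuous).symm)
    (ντ : Measure (archLocal L 3 (Matrix.diagonal (α ∘ ⇑ρ⁻¹)) w)) [ντ.IsHaarMeasure] [ντ.IsMulRightInvariant]
    (hντ : ντ = ν.map (ContinuousMulEquiv.restrictSubgroup (GLn.conjEquiv (Matrix.GeneralLinearGroup.mkOfDetNeZero _ (det_monomial_one_ne_zero 3 ρ⁻¹)))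
        (archLocal L 3 (Matrix.diagonal (α ∘ ⇑ρ⁻¹)) w) (archLocal L 3 (Matrix.diagonal α) w) (mem_archLocal_comp_perm_iff_conj_mem L 3 α w ρ⁻¹)).symm) :
    haveI : LocallyCompactSpace (archLocal L 3 (Matrix.diagonal (α ∘ ⇑ρ⁻¹)) w) := locallyCompactSpace_archLocal L 3 (Matrix.diagonal (α ∘ ⇑ρ⁻¹)) w
    haveI : SecondCountableTopology (archLocal L 3 (Matrix.diagonal (α ∘ ⇑ρ⁻¹)) w) := secondCountableTopology_archLocal L 3 (Matrix.diagonal (α ∘ ⇑ρ⁻¹)) w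
    haveI : LocallyCompactSpace (archLocal L 3 (Matrix.diagonal α) w) := locallyCompactSpace_archLocal L 3 (Matrix.diagonal α) w
    haveI : SecondCountableTopology (archLocal L 3 (Matrix.diagonal α) w) := secondCountableTopology_archLocal L 3 (Matrix.diagonal α) w
    ((quotientMeasure _ νH (isClosed_coe_centralizer_singleton _) ντ).map
        (descConj (⟨circleDiagonal 3 z₀, circleDiagonal_mem_archLocal_diagonal L 3 (α ∘ ⇑ρ⁻¹) w z₀⟩ : archLocal L 3 (Matrix.diagonal (α ∘ ⇑ρ⁻¹)) w) (Subgroup.centralizer ({(⟨circleDiagonal 3 z₁, circleDiagonal_mem_archLocal_diagonal L 3 (α ∘ ⇑ρ⁻¹) w z₁⟩ : archLocal L 3 (Matrix.diagonal (α ∘ ⇑ρ⁻¹)) w)} : Set (archLocal L 3 (Matrix.diagonal (α ∘ ⇑ρ⁻¹)) w))) (forall_mem_centralizer_circleDiagonal_comm_of_wall L (α ∘ ⇑ρ⁻¹) w h02 h01 h02' h01') id)).map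
      (ContinuousMulEquiv.restrictSubgroup (GLn.conjEquiv (Matrix.GeneralLinearGroup.mkOfDetNeZero _ (det_monomial_one_ne_zero 3 ρ⁻¹)))
        (archLocal L 3 (Matrix.diagonal (α ∘ ⇑ρ⁻¹)) w) (archLocal L 3 (Matrix.diagonal α) w) (mem_archLocal_comp_perm_iff_conj_mem L 3 α w ρ⁻¹)) =
      (quotientMeasure _ ρZ (isClosed_coe_centralizer_singleton _) ν).map
        (descConj (⟨circleDiagonal 3 (z₀ ∘ ⇑ρ), circleDiagonal_mem_archLocal_diagonal L 3 α w (z₀ ∘ ⇑ρ)⟩ : archLocal L 3 (Matrix.diagonal α) w) (Subgroup.centralizer ({(⟨circleDiagonal 3 (z₀ ∘ ⇑ρ), circleDiagonal_mem_archLocal_diagonal L 3 α w (z₀ ∘ ⇑ρ)⟩ : archLocal L 3 (Matrix.diagonal α) w)} : Set (archLocal L 3 (Matrix.diagonal α) w))) (fun _ hg => Subgroup.mem_centralizer_singleton_iff.1 hg) id) := by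
  refine map_map_descConj_quotientMeasure_relabel_inv_eq_of_eq L α w ν h02 h01 h02' h01' ρ νH ρZ ?_ ντ hντ
  rw [hνH, Measure.map_map (Homeomorph.continuous _).measurable (Homeomorph.continuous _).measurable]
  have hcomp : ((⇑(subgroupCongrHomeomorph (ContinuousMulEquiv.restrictSubgroup (GLn.conjEquiv (Matrix.GeneralLinearGroup.mkOfDetNeZero _ (det_monomial_one_ne_zero 3 ρ⁻¹)))
        (archLocal L 3 (Matrix.diagonal (α ∘ ⇑ρ⁻¹)) w) (archLocal L 3 (Matrix.diagonal α) w) (mem_archLocal_comp_perm_iff_conj_mem L 3 α w ρ⁻¹)).toMulEquiv (Subgroup.centralizer ({(⟨circleDiagonal 3 z₁, circleDiagonal_mem_archLocal_diagonal L 3 (α ∘ ⇑ρ⁻¹) w z₁⟩ : archLocal L 3 (Matrix.diagonal (α ∘ ⇑ρ⁻¹)) w)} : Set (archLocal L 3 (Matrix.diagonal (α ∘ ⇑ρ⁻¹)) w))) (Subgroup.centralizer ({(⟨circleDiagonal 3 (z₀ ∘ ⇑ρ), circleDiagonal_mem_archLocal_diagonal L 3 α w (z₀ ∘ ⇑ρ)⟩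 : archLocal L 3 (Matrix.diagonal α) w)} : Set (archLocal L 3 (Matrix.diagonal α) w)))
      (relabel_inv_mem_centralizer_circleDiagonal_comp_iff L α w ρ h02 h01 h02' h01') (ContinuousMulEquiv.restrictSubgroup (GLn.conjEquiv (Matrix.GeneralLinearGroup.mkOfDetNeZero _ (det_monomial_one_ne_zero 3 ρ⁻¹)))
        (archLocal L 3 (Matrix.diagonal (α ∘ ⇑ρ⁻¹)) w) (archLocal L 3 (Matrix.diagonal α) w) (mem_archLocal_comp_perm_iff_conj_mem L 3 α w ρ⁻¹)).continuous (ContinuousMulEquiv.restrictSubgroup (GLn.conjEquiv (Matrix.GeneralLinearGroup.mkOfDetNeZero _ (det_monomial_one_ne_zero 3 ρ⁻¹)))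
        (archLocal L 3 (Matrix.diagonal (α ∘ ⇑ρ⁻¹)) w) (archLocal L 3 (Matrix.diagonal α) w) (mem_archLocal_comp_perm_iff_conj_mem L 3 α w ρ⁻¹)).symm.continuous)) ∘
      (⇑(subgroupCongrHomeomorph (ContinuousMulEquiv.restrictSubgroup (GLn.conjEquiv (Matrix.GeneralLinearGroup.mkOfDetNeZero _ (det_monomial_one_ne_zero 3 ρ⁻¹)))
        (archLocal L 3 (Matrix.diagonal (α ∘ ⇑ρ⁻¹)) w) (archLocal L 3 (Matrix.diagonal α) w) (mem_archLocal_comp_perm_iff_conj_mem L 3 α w ρ⁻¹)).toMulEquiv (Subgroup.centralizer ({(⟨circleDiagonal 3 z₁, circleDiagonal_mem_archLocal_diagonal L 3 (α ∘ ⇑ρ⁻¹) w z₁⟩ : archLocal L 3 (Matrix.diagonal (α ∘ ⇑ρ⁻¹)) w)} : Set (archLocal L 3 (Matrix.diagonal (α ∘ ⇑ρ⁻¹)) w))) (Subgroup.centralizer ({(⟨circleDiagonal 3 (z₀ ∘ ⇑ρ), circleDiagonal_mem_archLocal_diagonal L 3 α w (z₀ ∘ ⇑ρ)⟩ : archLocal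 L 3 (Matrix.diagonal α) w)} : Set (archLocal L 3 (Matrix.diagonal α) w)))
      (relabel_inv_mem_centralizer_circleDiagonal_comp_iff L α w ρ h02 h01 h02' h01') (ContinuousMulEquiv.restrictSubgroup (GLn.conjEquiv (Matrix.GeneralLinearGroup.mkOfDetNeZero _ (det_monomial_one_ne_zero 3 ρ⁻¹)))
        (archLocal L 3 (Matrix.diagonal (α ∘ ⇑ρ⁻¹)) w) (archLocal L 3 (Matrix.diagonal α) w) (mem_archLocal_comp_perm_iff_conj_mem L 3 α w ρ⁻¹)).continuous (ContinuousMulEquiv.restrictSubgroup (GLn.conjEquiv (Matrix.GeneralLinearGroup.mkOfDetNeZero _ (det_monomial_one_ne_zero 3 ρ⁻¹)))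
        (archLocal L 3 (Matrix.diagonal (α ∘ ⇑ρ⁻¹)) w) (archLocal L 3 (Matrix.diagonal α) w) (mem_archLocal_comp_perm_iff_conj_mem L 3 α w ρ⁻¹)).symm.continuous).symm)) = id :=
    funext fun x => Homeomorph.apply_symm_apply _ x
  rw [hcomp, Measure.map_id]

open scoped Classical in
/-- **(R1-h-ab) EVERY WALL FACTOR OF ★ p841776 IS A SCALAR TIMES THE WEIL-QUOTIENT ORBIT MEASURE AT `diag(z⁰ ∘ ρ)`** — the `if cw then (Haar push-forward) else (transported singular
measure)` factor of ★ `exists_wallCoef_sum_prod_mul_eq_of_regular_eq` (side `α`, place `w`, relabelling `ρ`) equals `(cw ? ρ_Z(Z) : 1) • ((ν∕ρ_Z).map orbit_{diag(z⁰∘ρ)})` for a centraliser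
measure `ρ_Z` on `Z(diag(z⁰∘ρ)) ≤ G_w(α)` which at a NONCOMPACT wall is the transported reference measure `(e_{ρ⁻¹}|_Z)_* νH` (hypothesis `hρZ`; at a compact wall `ρ_Z` is free).
[cite: Rogawski1990, §8.2 pp. 122–124; §1.7 p. 6] [cite: DeitmarEchterhoff2014, Thm. 1.5.3, Cor. 1.5.4] [cite: Folland1995, §2.6 (2.52)] -/
theorem wallFactor_eq_smul_map_descConj_quotientMeasure (ρ : Perm (Fin 3))
    [MeasurableSpace (archLocal L 3 (Matrix.diagonal (α ∘ ⇑ρ⁻¹)) w ⧸ (Subgroup.centralizer ({(⟨circleDiagonal 3 z₁, circleDiagonal_mem_archLocal_diagonal L 3 (α ∘ ⇑ρ⁻¹) w z₁⟩ : archLocal L 3 (Matrix.diagonal (α ∘ ⇑ρ⁻¹)) w)} : Set (archLocal L 3 (Matrix.diagonal (α ∘ ⇑ρ⁻¹)) w))))] [BorelSpace (archLocal L 3 (Matrix.diagonal (α ∘ ⇑ρ⁻¹)) w ⧸ (Subgroup.centralizer ({(⟨circleDiagonal 3 z₁, circleDiagonal_mem_archLocal_diagonal L 3 (α ∘ ⇑ρ⁻¹)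 w z₁⟩ : archLocal L 3 (Matrix.diagonal (α ∘ ⇑ρ⁻¹)) w)} : Set (archLocal L 3 (Matrix.diagonal (α ∘ ⇑ρ⁻¹)) w))))]
    [MeasurableSpace (archLocal L 3 (Matrix.diagonal α) w ⧸ (Subgroup.centralizer ({(⟨circleDiagonal 3 (z₀ ∘ ⇑ρ), circleDiagonal_mem_archLocal_diagonal L 3 α w (z₀ ∘ ⇑ρ)⟩ : archLocal L 3 (Matrix.diagonal α) w)} : Set (archLocal L 3 (Matrix.diagonal α) w))))] [BorelSpace (archLocal L 3 (Matrix.diagonal α) w ⧸ (Subgroup.centralizer ({(⟨circleDiagonal 3 (z₀ ∘ ⇑ρ), circleDiagonal_mem_archLocal_diagonal L 3 α w (z₀ ∘ ⇑ρ)⟩ : archLocal L 3 (Matrix.diagonal α) w)} : Set (archLocal L 3 (Matrix.diagonal α) w))))]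
    (νH : Measure (Subgroup.centralizer ({(⟨circleDiagonal 3 z₁, circleDiagonal_mem_archLocal_diagonal L 3 (α ∘ ⇑ρ⁻¹) w z₁⟩ : archLocal L 3 (Matrix.diagonal (α ∘ ⇑ρ⁻¹)) w)} : Set (archLocal L 3 (Matrix.diagonal (α ∘ ⇑ρ⁻¹)) w)))) [νH.IsHaarMeasure] [νH.IsInvInvariant]
    (ντ : Measure (archLocal L 3 (Matrix.diagonal (α ∘ ⇑ρ⁻¹)) w)) [ντ.IsHaarMeasure] [ντ.IsMulRightInvariant]
    (hντ : ντ = ν.map (ContinuousMulEquiv.restrictSubgroup (GLn.conjEquiv (Matrix.GeneralLinearGroup.mkOfDetNeZero _ (det_monomial_one_ne_zero 3 ρ⁻¹)))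
        (archLocal L 3 (Matrix.diagonal (α ∘ ⇑ρ⁻¹)) w) (archLocal L 3 (Matrix.diagonal α) w) (mem_archLocal_comp_perm_iff_conj_mem L 3 α w ρ⁻¹)).symm)
    (ρZ : Measure (Subgroup.centralizer ({(⟨circleDiagonal 3 (z₀ ∘ ⇑ρ), circleDiagonal_mem_archLocal_diagonal L 3 α w (z₀ ∘ ⇑ρ)⟩ : archLocal L 3 (Matrix.diagonal α) w)} : Set (archLocal L 3 (Matrix.diagonal α) w)))) [ρZ.IsHaarMeasure] [ρZ.IsInvInvariant]
    (hρZ : ¬ 0 < (w.1.embedding (α (ρ⁻¹ 0))).re * (w.1.embedding (α (ρ⁻¹ 2))).re → ρZ = νH.map (subgroupCongrHomeomorph (ContinuousMulEquiv.restrictSubgroup (GLn.conjEquiv (Matrix.GeneralLinearGroup.mkOfDetNeZero _ (det_monomial_one_ne_zero 3 ρ⁻¹)))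
        (archLocal L 3 (Matrix.diagonal (α ∘ ⇑ρ⁻¹)) w) (archLocal L 3 (Matrix.diagonal α) w) (mem_archLocal_comp_perm_iff_conj_mem L 3 α w ρ⁻¹)).toMulEquiv (Subgroup.centralizer ({(⟨circleDiagonal 3 z₁, circleDiagonal_mem_archLocal_diagonal L 3 (α ∘ ⇑ρ⁻¹) w z₁⟩ : archLocal L 3 (Matrix.diagonal (α ∘ ⇑ρ⁻¹)) w)} : Set (archLocal L 3 (Matrix.diagonal (α ∘ ⇑ρ⁻¹)) w))) (Subgroup.centralizer ({(⟨circleDiagonal 3 (z₀ ∘ ⇑ρ), circleDiagonal_mem_archLocal_diagonal L 3 α w (z₀ ∘ ⇑ρ)⟩ : archLocal L 3 (Matrix.diagonal α) w)} : Set (archLocal L 3 (Matrix.diagonal α) w)))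
      (relabel_inv_mem_centralizer_circleDiagonal_comp_iff L α w ρ h02 h01 h02' h01') (ContinuousMulEquiv.restrictSubgroup (GLn.conjEquiv (Matrix.GeneralLinearGroup.mkOfDetNeZero _ (det_monomial_one_ne_zero 3 ρ⁻¹)))
        (archLocal L 3 (Matrix.diagonal (α ∘ ⇑ρ⁻¹)) w) (archLocal L 3 (Matrix.diagonal α) w) (mem_archLocal_comp_perm_iff_conj_mem L 3 α w ρ⁻¹)).continuous (ContinuousMulEquiv.restrictSubgroup (GLn.conjEquiv (Matrix.GeneralLinearGroup.mkOfDetNeZero _ (det_monomial_one_ne_zero 3 ρ⁻¹)))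
        (archLocal L 3 (Matrix.diagonal (α ∘ ⇑ρ⁻¹)) w) (archLocal L 3 (Matrix.diagonal α) w) (mem_archLocal_comp_perm_iff_conj_mem L 3 α w ρ⁻¹)).symm.continuous)) :
    haveI : LocallyCompactSpace (archLocal L 3 (Matrix.diagonal (α ∘ ⇑ρ⁻¹)) w) := locallyCompactSpace_archLocal L 3 (Matrix.diagonal (α ∘ ⇑ρ⁻¹)) w
    haveI : SecondCountableTopology (archLocal L 3 (Matrix.diagonal (α ∘ ⇑ρ⁻¹)) w) := secondCountableTopology_archLocal L 3 (Matrix.diagonal (α ∘ ⇑ρ⁻¹)) w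
    haveI : LocallyCompactSpace (archLocal L 3 (Matrix.diagonal α) w) := locallyCompactSpace_archLocal L 3 (Matrix.diagonal α) w
    haveI : SecondCountableTopology (archLocal L 3 (Matrix.diagonal α) w) := secondCountableTopology_archLocal L 3 (Matrix.diagonal α) w
    (if 0 < (w.1.embedding (α (ρ⁻¹ 0))).re * (w.1.embedding (α (ρ⁻¹ 2))).re then
        ν.map fun y : archLocal L 3 (Matrix.diagonal α) w => y * (⟨circleDiagonal 3 (z₀ ∘ ⇑ρ), circleDiagonal_mem_archLocal_diagonal L 3 α w (z₀ ∘ ⇑ρ)⟩ : archLocal L 3 (Matrix.diagonal α) w) * y⁻¹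
      else ((quotientMeasure _ νH (isClosed_coe_centralizer_singleton _) ντ).map
        (descConj (⟨circleDiagonal 3 z₀, circleDiagonal_mem_archLocal_diagonal L 3 (α ∘ ⇑ρ⁻¹) w z₀⟩ : archLocal L 3 (Matrix.diagonal (α ∘ ⇑ρ⁻¹)) w) (Subgroup.centralizer ({(⟨circleDiagonal 3 z₁, circleDiagonal_mem_archLocal_diagonal L 3 (α ∘ ⇑ρ⁻¹) w z₁⟩ : archLocal L 3 (Matrix.diagonal (α ∘ ⇑ρ⁻¹)) w)} : Set (archLocal L 3 (Matrix.diagonal (α ∘ ⇑ρ⁻¹)) w))) (forall_mem_centralizer_circleDiagonal_comm_of_wall L (α ∘ ⇑ρ⁻¹) w h02 h01 h02' h01') id)).map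
      (ContinuousMulEquiv.restrictSubgroup (GLn.conjEquiv (Matrix.GeneralLinearGroup.mkOfDetNeZero _ (det_monomial_one_ne_zero 3 ρ⁻¹)))
        (archLocal L 3 (Matrix.diagonal (α ∘ ⇑ρ⁻¹)) w) (archLocal L 3 (Matrix.diagonal α) w) (mem_archLocal_comp_perm_iff_conj_mem L 3 α w ρ⁻¹))) =
      (if 0 < (w.1.embedding (α (ρ⁻¹ 0))).re * (w.1.embedding (α (ρ⁻¹ 2))).re then ρZ Set.univ else 1) •
        (quotientMeasure _ ρZ (isClosed_coe_centralizer_singleton _) ν).map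
          (descConj (⟨circleDiagonal 3 (z₀ ∘ ⇑ρ), circleDiagonal_mem_archLocal_diagonal L 3 α w (z₀ ∘ ⇑ρ)⟩ : archLocal L 3 (Matrix.diagonal α) w) (Subgroup.centralizer ({(⟨circleDiagonal 3 (z₀ ∘ ⇑ρ), circleDiagonal_mem_archLocal_diagonal L 3 α w (z₀ ∘ ⇑ρ)⟩ : archLocal L 3 (Matrix.diagonal α) w)} : Set (archLocal L 3 (Matrix.diagonal α) w))) (fun _ hg => Subgroup.mem_centralizer_singleton_iff.1 hg) id) := by
  split_ifs with hcw
  · exact map_conj_circleDiagonal_comp_eq_measure_univ_smul L α w ν ρ ρZ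
  · rw [one_smul]
    exact map_map_descConj_quotientMeasure_relabel_inv_eq_of_eq L α w ν h02 h01 h02' h01' ρ νH ρZ (hρZ hcw) ντ hντ

open scoped Classical in
/-- **THE SAME WITH AN `ℝ≥0` SCALAR** (the currency of ★ (R1-h-c) `pi_nnreal_smul` ∕ `integral_comp_archPiEquivCM_symm_pi_smul_map_descConj_eq_smul_classOrbitalIntegral`): at a compact
wall the centraliser `Z(diag(z⁰∘ρ)) ≅ U(2) × U(1)` is compact (★ (δ′) `compactSpace_centralizer_circleDiagonal_comp_of_pos`, from `hα` and the reality of `σ_w α`), so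
`ρ_Z(Z) < ∞` and the factor is `(ρ_Z(Z)).toNNReal • orbit measure`. [cite: Rogawski1990, §8.2 pp. 122–124; §1.7 p. 6] [cite: Folland1995, §2.6 (2.52)] -/
theorem wallFactor_eq_nnreal_smul_map_descConj_quotientMeasure (hα : ∀ i, α i ≠ 0) (hreal : ∀ i, (w.1.embedding (α i)).im = 0) (ρ : Perm (Fin 3))
    [MeasurableSpace (archLocal L 3 (Matrix.diagonal (α ∘ ⇑ρ⁻¹)) w ⧸ (Subgroup.centralizer ({(⟨circleDiagonal 3 z₁, circleDiagonal_mem_archLocal_diagonal L 3 (α ∘ ⇑ρ⁻¹) w z₁⟩ : archLocal L 3 (Matrix.diagonal (α ∘ ⇑ρ⁻¹)) w)} : Set (archLocal L 3 (Matrix.diagonal (α ∘ ⇑ρ⁻¹)) w))))] [BorelSpace (archLocal L 3 (Matrix.diagonal (α ∘ ⇑ρ⁻¹)) w ⧸ (Subgroup.centralizer ({(⟨circleDiagonal 3 z₁, circleDiagonal_mem_archLocal_diagonal L 3 (α ∘ ⇑ρ⁻¹) w z₁⟩ : archLocal L 3 (Matrix.diagonal (α ∘ ⇑ρ⁻¹))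 w)} : Set (archLocal L 3 (Matrix.diagonal (α ∘ ⇑ρ⁻¹)) w))))]
    [MeasurableSpace (archLocal L 3 (Matrix.diagonal α) w ⧸ (Subgroup.centralizer ({(⟨circleDiagonal 3 (z₀ ∘ ⇑ρ), circleDiagonal_mem_archLocal_diagonal L 3 α w (z₀ ∘ ⇑ρ)⟩ : archLocal L 3 (Matrix.diagonal α) w)} : Set (archLocal L 3 (Matrix.diagonal α) w))))] [BorelSpace (archLocal L 3 (Matrix.diagonal α) w ⧸ (Subgroup.centralizer ({(⟨circleDiagonal 3 (z₀ ∘ ⇑ρ), circleDiagonal_mem_archLocal_diagonal L 3 α w (z₀ ∘ ⇑ρ)⟩ : archLocal L 3 (Matrix.diagonal α) w)} : Set (archLocal L 3 (Matrix.diagonal α) w))))]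
    (νH : Measure (Subgroup.centralizer ({(⟨circleDiagonal 3 z₁, circleDiagonal_mem_archLocal_diagonal L 3 (α ∘ ⇑ρ⁻¹) w z₁⟩ : archLocal L 3 (Matrix.diagonal (α ∘ ⇑ρ⁻¹)) w)} : Set (archLocal L 3 (Matrix.diagonal (α ∘ ⇑ρ⁻¹)) w)))) [νH.IsHaarMeasure] [νH.IsInvInvariant]
    (ντ : Measure (archLocal L 3 (Matrix.diagonal (α ∘ ⇑ρ⁻¹)) w)) [ντ.IsHaarMeasure] [ντ.IsMulRightInvariant]
    (hντ : ντ = ν.map (ContinuousMulEquiv.restrictSubgroup (GLn.conjEquiv (Matrix.GeneralLinearGroup.mkOfDetNeZero _ (det_monomial_one_ne_zero 3 ρ⁻¹)))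
        (archLocal L 3 (Matrix.diagonal (α ∘ ⇑ρ⁻¹)) w) (archLocal L 3 (Matrix.diagonal α) w) (mem_archLocal_comp_perm_iff_conj_mem L 3 α w ρ⁻¹)).symm)
    (ρZ : Measure (Subgroup.centralizer ({(⟨circleDiagonal 3 (z₀ ∘ ⇑ρ), circleDiagonal_mem_archLocal_diagonal L 3 α w (z₀ ∘ ⇑ρ)⟩ : archLocal L 3 (Matrix.diagonal α) w)} : Set (archLocal L 3 (Matrix.diagonal α) w)))) [ρZ.IsHaarMeasure] [ρZ.IsInvInvariant]
    (hρZ : ¬ 0 < (w.1.embedding (α (ρ⁻¹ 0))).re * (w.1.embedding (α (ρ⁻¹ 2))).re → ρZ = νH.map (subgroupCongrHomeomorph (ContinuousMulEquiv.restrictSubgroup (GLn.conjEquiv (Matrix.GeneralLinearGroup.mkOfDetNeZero _ (det_monomial_one_ne_zero 3 ρ⁻¹)))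
        (archLocal L 3 (Matrix.diagonal (α ∘ ⇑ρ⁻¹)) w) (archLocal L 3 (Matrix.diagonal α) w) (mem_archLocal_comp_perm_iff_conj_mem L 3 α w ρ⁻¹)).toMulEquiv (Subgroup.centralizer ({(⟨circleDiagonal 3 z₁, circleDiagonal_mem_archLocal_diagonal L 3 (α ∘ ⇑ρ⁻¹) w z₁⟩ : archLocal L 3 (Matrix.diagonal (α ∘ ⇑ρ⁻¹)) w)} : Set (archLocal L 3 (Matrix.diagonal (α ∘ ⇑ρ⁻¹)) w))) (Subgroup.centralizer ({(⟨circleDiagonal 3 (z₀ ∘ ⇑ρ), circleDiagonal_mem_archLocal_diagonal L 3 α w (z₀ ∘ ⇑ρ)⟩ : archLocal L 3 (Matrix.diagonal α) w)} : Set (archLocal L 3 (Matrix.diagonal α) w)))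
      (relabel_inv_mem_centralizer_circleDiagonal_comp_iff L α w ρ h02 h01 h02' h01') (ContinuousMulEquiv.restrictSubgroup (GLn.conjEquiv (Matrix.GeneralLinearGroup.mkOfDetNeZero _ (det_monomial_one_ne_zero 3 ρ⁻¹)))
        (archLocal L 3 (Matrix.diagonal (α ∘ ⇑ρ⁻¹)) w) (archLocal L 3 (Matrix.diagonal α) w) (mem_archLocal_comp_perm_iff_conj_mem L 3 α w ρ⁻¹)).continuous (ContinuousMulEquiv.restrictSubgroup (GLn.conjEquiv (Matrix.GeneralLinearGroup.mkOfDetNeZero _ (det_monomial_one_ne_zero 3 ρ⁻¹)))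
        (archLocal L 3 (Matrix.diagonal (α ∘ ⇑ρ⁻¹)) w) (archLocal L 3 (Matrix.diagonal α) w) (mem_archLocal_comp_perm_iff_conj_mem L 3 α w ρ⁻¹)).symm.continuous)) :
    haveI : LocallyCompactSpace (archLocal L 3 (Matrix.diagonal (α ∘ ⇑ρ⁻¹)) w) := locallyCompactSpace_archLocal L 3 (Matrix.diagonal (α ∘ ⇑ρ⁻¹)) w
    haveI : SecondCountableTopology (archLocal L 3 (Matrix.diagonal (α ∘ ⇑ρ⁻¹)) w) := secondCountableTopology_archLocal L 3 (Matrix.diagonal (α ∘ ⇑ρ⁻¹)) w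
    haveI : LocallyCompactSpace (archLocal L 3 (Matrix.diagonal α) w) := locallyCompactSpace_archLocal L 3 (Matrix.diagonal α) w
    haveI : SecondCountableTopology (archLocal L 3 (Matrix.diagonal α) w) := secondCountableTopology_archLocal L 3 (Matrix.diagonal α) w
    (if 0 < (w.1.embedding (α (ρ⁻¹ 0))).re * (w.1.embedding (α (ρ⁻¹ 2))).re then
        ν.map fun y : archLocal L 3 (Matrix.diagonal α) w => y * (⟨circleDiagonal 3 (z₀ ∘ ⇑ρ), circleDiagonal_mem_archLocal_diagonal L 3 α w (z₀ ∘ ⇑ρ)⟩ : archLocal L 3 (Matrix.diagonal α) w) * y⁻¹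
      else ((quotientMeasure _ νH (isClosed_coe_centralizer_singleton _) ντ).map
        (descConj (⟨circleDiagonal 3 z₀, circleDiagonal_mem_archLocal_diagonal L 3 (α ∘ ⇑ρ⁻¹) w z₀⟩ : archLocal L 3 (Matrix.diagonal (α ∘ ⇑ρ⁻¹)) w) (Subgroup.centralizer ({(⟨circleDiagonal 3 z₁, circleDiagonal_mem_archLocal_diagonal L 3 (α ∘ ⇑ρ⁻¹) w z₁⟩ : archLocal L 3 (Matrix.diagonal (α ∘ ⇑ρ⁻¹)) w)} : Set (archLocal L 3 (Matrix.diagonal (α ∘ ⇑ρ⁻¹)) w))) (forall_mem_centralizer_circleDiagonal_comm_of_wall L (α ∘ ⇑ρ⁻¹) w h02 h01 h02' h01') id)).map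
      (ContinuousMulEquiv.restrictSubgroup (GLn.conjEquiv (Matrix.GeneralLinearGroup.mkOfDetNeZero _ (det_monomial_one_ne_zero 3 ρ⁻¹)))
        (archLocal L 3 (Matrix.diagonal (α ∘ ⇑ρ⁻¹)) w) (archLocal L 3 (Matrix.diagonal α) w) (mem_archLocal_comp_perm_iff_conj_mem L 3 α w ρ⁻¹))) =
      ((if 0 < (w.1.embedding (α (ρ⁻¹ 0))).re * (w.1.embedding (α (ρ⁻¹ 2))).re then (ρZ Set.univ).toNNReal else 1 : ℝ≥0)) •
        (quotientMeasure _ ρZ (isClosed_coe_centralizer_singleton _) ν).map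
          (descConj (⟨circleDiagonal 3 (z₀ ∘ ⇑ρ), circleDiagonal_mem_archLocal_diagonal L 3 α w (z₀ ∘ ⇑ρ)⟩ : archLocal L 3 (Matrix.diagonal α) w) (Subgroup.centralizer ({(⟨circleDiagonal 3 (z₀ ∘ ⇑ρ), circleDiagonal_mem_archLocal_diagonal L 3 α w (z₀ ∘ ⇑ρ)⟩ : archLocal L 3 (Matrix.diagonal α) w)} : Set (archLocal L 3 (Matrix.diagonal α) w))) (fun _ hg => Subgroup.mem_centralizer_singleton_iff.1 hg) id) := by
  rw [wallFactor_eq_smul_map_descConj_quotientMeasure L α w ν h02 h01 h02' h01' ρ νH ντ hντ ρZ hρZ]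
  split_ifs with hcw
  · haveI := compactSpace_centralizer_circleDiagonal_comp_of_pos L α w hα hreal ρ hcw h02' h01'
    have hne : ρZ Set.univ ≠ ⊤ := (isCompact_univ.measure_lt_top (μ := ρZ)).ne
    ext s hs
    rw [Measure.smul_apply, Measure.coe_nnreal_smul_apply, ENNReal.coe_toNNReal hne, smul_eq_mul]
  · rw [one_smul, one_smul]

end Carrier

section Radon

variable (L : Type) [Field L] [NumberField L] [IsCMField L] (α : Fin 3 → L) (w : {w : InfinitePlace L // IsComplex w})
  [MeasurableSpace (GL (Fin 3) ℂ)] [BorelSpace (GL (Fin 3) ℂ)]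

omit [NumberField L] [IsCMField L] [MeasurableSpace (GL (Fin 3) ℂ)] [BorelSpace (GL (Fin 3) ℂ)] in
/-- A RELABELLED wall point `diag(z⁰ ∘ ρ)` is split semisimple: `(t − z⁰₀)(t − z⁰₁) = 0` (its eigenvalues are `z⁰_{ρ i} ∈ {z⁰₀, z⁰₁}` as `z⁰₂ = z⁰₀`; cf. ★ `mul_sub_eq_zero_circleDiagonal_wall`).
[cite: Rogawski1990, §8.2 p. 122] -/
theorem mul_sub_eq_zero_circleDiagonal_comp_wall (ρ : Perm (Fin 3)) {z₀ : Fin 3 → Circle} (h02' : z₀ 0 = z₀ 2) :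
    (((((⟨circleDiagonal 3 (z₀ ∘ ⇑ρ), circleDiagonal_mem_archLocal_diagonal L 3 α w (z₀ ∘ ⇑ρ)⟩ : archLocal L 3 (Matrix.diagonal α) w)).val : GL (Fin 3) ℂ) :
        Matrix (Fin 3) (Fin 3) ℂ) - (z₀ 0 : ℂ) • (1 : Matrix (Fin 3) (Fin 3) ℂ)) *
      (((((⟨circleDiagonal 3 (z₀ ∘ ⇑ρ), circleDiagonal_mem_archLocal_diagonal L 3 α w (z₀ ∘ ⇑ρ)⟩ : archLocal L 3 (Matrix.diagonal α) w)).val : GL (Fin 3) ℂ) :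
        Matrix (Fin 3) (Fin 3) ℂ) - (z₀ 1 : ℂ) • (1 : Matrix (Fin 3) (Fin 3) ℂ)) = 0 := by
  have h02c : ((z₀ 2 : Circle) : ℂ) = z₀ 0 := by rw [h02']
  have hj : ∀ j : Fin 3, ((z₀ j : ℂ) - z₀ 0) * ((z₀ j : ℂ) - z₀ 1) = 0 := by
    intro j
    fin_cases j
    · simp
    · simp
    · simp [h02c]
  rw [show (((((⟨circleDiagonal 3 (z₀ ∘ ⇑ρ), circleDiagonal_mem_archLocal_diagonal L 3 α w (z₀ ∘ ⇑ρ)⟩ : archLocal L 3 (Matrix.diagonal α) w)).val : GL (Fin 3) ℂ) :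
      Matrix (Fin 3) (Fin 3) ℂ)) = Matrix.diagonal fun j => ((z₀ ∘ ⇑ρ) j : ℂ) from coe_circleDiagonal 3 (z₀ ∘ ⇑ρ),
    UnitaryGroup.diagonal_sub_smul_one, UnitaryGroup.diagonal_sub_smul_one, Matrix.diagonal_mul_diagonal, ← Matrix.diagonal_zero]
  congr 1
  funext m
  exact hj (ρ m)

/-- **THE WEIL-QUOTIENT ORBIT MEASURE AT A (RELABELLED) WALL POINT IS RADON** — finite on compacts and σ-finite: the class of the split semisimple `diag(z⁰∘ρ)` is closed
(★ `isClosed_conjClass_archLocal_of_mul_sub_eq_zero`), so the orbit map is proper (★ (R1-f) `isFiniteMeasureOnCompacts_map_descConj_id`).  The σ-finiteness every `Measure.pi`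
manipulation of the end state needs. [cite: Rogawski1990, §14.5 pp. 238–239; §8.2 p. 123] [cite: DeitmarEchterhoff2014, Lemma 9.3.3] -/
theorem isFiniteMeasureOnCompacts_and_sigmaFinite_map_descConj_quotientMeasure_wall (hα : ∀ i, α i ≠ 0) (hherm : ∀ i, (IsCMField.complexConj L (α i) : L) = α i)
    (ν : Measure (archLocal L 3 (Matrix.diagonal α) w)) [ν.IsHaarMeasure] [ν.IsMulRightInvariant]
    (ρ : Perm (Fin 3)) {z₀ : Fin 3 → Circle} (h02' : z₀ 0 = z₀ 2) (h01' : z₀ 0 ≠ z₀ 1)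
    [MeasurableSpace (archLocal L 3 (Matrix.diagonal α) w ⧸ (Subgroup.centralizer ({(⟨circleDiagonal 3 (z₀ ∘ ⇑ρ), circleDiagonal_mem_archLocal_diagonal L 3 α w (z₀ ∘ ⇑ρ)⟩ : archLocal L 3 (Matrix.diagonal α) w)} : Set (archLocal L 3 (Matrix.diagonal α) w))))] [BorelSpace (archLocal L 3 (Matrix.diagonal α) w ⧸ (Subgroup.centralizer ({(⟨circleDiagonal 3 (z₀ ∘ ⇑ρ), circleDiagonal_mem_archLocal_diagonal L 3 α w (z₀ ∘ ⇑ρ)⟩ : archLocal L 3 (Matrix.diagonal α) w)} : Set (archLocal L 3 (Matrix.diagonal α) w))))]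
    (ρZ : Measure (Subgroup.centralizer ({(⟨circleDiagonal 3 (z₀ ∘ ⇑ρ), circleDiagonal_mem_archLocal_diagonal L 3 α w (z₀ ∘ ⇑ρ)⟩ : archLocal L 3 (Matrix.diagonal α) w)} : Set (archLocal L 3 (Matrix.diagonal α) w)))) [ρZ.IsHaarMeasure] [ρZ.IsInvInvariant] :
    haveI : LocallyCompactSpace (archLocal L 3 (Matrix.diagonal α) w) := locallyCompactSpace_archLocal L 3 (Matrix.diagonal α) w
    haveI : SecondCountableTopology (archLocal L 3 (Matrix.diagonal α) w) := secondCountableTopology_archLocal L 3 (Matrix.diagonal α) w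
    IsFiniteMeasureOnCompacts ((quotientMeasure _ ρZ (isClosed_coe_centralizer_singleton _) ν).map
        (descConj (⟨circleDiagonal 3 (z₀ ∘ ⇑ρ), circleDiagonal_mem_archLocal_diagonal L 3 α w (z₀ ∘ ⇑ρ)⟩ : archLocal L 3 (Matrix.diagonal α) w) (Subgroup.centralizer ({(⟨circleDiagonal 3 (z₀ ∘ ⇑ρ), circleDiagonal_mem_archLocal_diagonal L 3 α w (z₀ ∘ ⇑ρ)⟩ : archLocal L 3 (Matrix.diagonal α) w)} : Set (archLocal L 3 (Matrix.diagonal α) w))) (fun _ hg => Subgroup.mem_centralizer_singleton_iff.1 hg) id)) ∧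
      SigmaFinite ((quotientMeasure _ ρZ (isClosed_coe_centralizer_singleton _) ν).map
        (descConj (⟨circleDiagonal 3 (z₀ ∘ ⇑ρ), circleDiagonal_mem_archLocal_diagonal L 3 α w (z₀ ∘ ⇑ρ)⟩ : archLocal L 3 (Matrix.diagonal α) w) (Subgroup.centralizer ({(⟨circleDiagonal 3 (z₀ ∘ ⇑ρ), circleDiagonal_mem_archLocal_diagonal L 3 α w (z₀ ∘ ⇑ρ)⟩ : archLocal L 3 (Matrix.diagonal α) w)} : Set (archLocal L 3 (Matrix.diagonal α) w))) (fun _ hg => Subgroup.mem_centralizer_singleton_iff.1 hg) id)) := by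
  haveI : LocallyCompactSpace (archLocal L 3 (Matrix.diagonal α) w) := locallyCompactSpace_archLocal L 3 (Matrix.diagonal α) w
  haveI : SecondCountableTopology (archLocal L 3 (Matrix.diagonal α) w) := secondCountableTopology_archLocal L 3 (Matrix.diagonal α) w
  have hdet : (Matrix.diagonal α).det ≠ 0 := by
    rw [Matrix.det_diagonal]; exact Finset.prod_ne_zero_iff.mpr fun i _ => hα _
  have hab : ((z₀ 0 : Circle) : ℂ) ≠ z₀ 1 := fun h => h01' (Subtype.val_injective h)
  have hO := isClosed_conjClass_archLocal_of_mul_sub_eq_zero L 3 (Matrix.diagonal α) w (map_cmConjRingHom_transpose_diagonal L α hherm) hdet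
    (⟨circleDiagonal 3 (z₀ ∘ ⇑ρ), circleDiagonal_mem_archLocal_diagonal L 3 α w (z₀ ∘ ⇑ρ)⟩ : archLocal L 3 (Matrix.diagonal α) w) hab (mul_sub_eq_zero_circleDiagonal_comp_wall L α w ρ h02')
  haveI hfc := isFiniteMeasureOnCompacts_map_descConj_id (⟨circleDiagonal 3 (z₀ ∘ ⇑ρ), circleDiagonal_mem_archLocal_diagonal L 3 α w (z₀ ∘ ⇑ρ)⟩ : archLocal L 3 (Matrix.diagonal α) w) (Subgroup.centralizer ({(⟨circleDiagonal 3 (z₀ ∘ ⇑ρ), circleDiagonal_mem_archLocal_diagonal L 3 α w (z₀ ∘ ⇑ρ)⟩ : archLocal L 3 (Matrix.diagonal α) w)} : Set (archLocal L 3 (Matrix.diagonal α) w))) (fun _ hg => Subgroup.mem_centralizer_singleton_iff.1 hg) hO rfl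
    (quotientMeasure _ ρZ (isClosed_coe_centralizer_singleton _) ν)
  haveI : IsLocallyFiniteMeasure ((quotientMeasure _ ρZ (isClosed_coe_centralizer_singleton _) ν).map
        (descConj (⟨circleDiagonal 3 (z₀ ∘ ⇑ρ), circleDiagonal_mem_archLocal_diagonal L 3 α w (z₀ ∘ ⇑ρ)⟩ : archLocal L 3 (Matrix.diagonal α) w) (Subgroup.centralizer ({(⟨circleDiagonal 3 (z₀ ∘ ⇑ρ), circleDiagonal_mem_archLocal_diagonal L 3 α w (z₀ ∘ ⇑ρ)⟩ : archLocal L 3 (Matrix.diagonal α) w)} : Set (archLocal L 3 (Matrix.diagonal α) w))) (fun _ hg => Subgroup.mem_centralizer_singleton_iff.1 hg) id)) :=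
    isLocallyFiniteMeasure_of_isFiniteMeasureOnCompacts
  exact ⟨hfc, sigmaFinite_of_locallyFinite⟩

end Radon

end Literature.NumberTheory.Rogawski1990

end
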